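import Summits.AtomisticToContinuum.BoseEinsteinCondensation.Theses.BECCutLineWeakDisorder
import Summits.AtomisticToContinuum.BoseEinsteinCondensation.Theorems.BECCutLineWeakDisorderWitnessTransferHeig
import Summits.AtomisticToContinuum.BoseEinsteinCondensation.Theorems.BECCutLineWeakDisorderWitnessTransferEnvelope
import Summits.AtomisticToContinuum.BoseEinsteinCondensation.Theorems.BECCutLineWeakDisorderWitnessTransferFormBound
import Summits.AtomisticToContinuum.BoseEinsteinCondensation.Theorems.BECCutLineWeakDisorderWitnessTransferTrialState
import Summits.AtomisticToContinuum.BoseEinsteinCondensation.Theorems.BECCutLineWeakDisorderWitnessTransferRatioMollify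
import Summits.AtomisticToContinuum.BoseEinsteinCondensation.Theorems.BECCutLineWeakDisorderWitnessTransferGlue
import Summits.AtomisticToContinuum.BoseEinsteinCondensation.Theorems.BECCutLineWeakDisorderWitnessTransferVanishOfPointwise
import Summits.AtomisticToContinuum.BoseEinsteinCondensation.Theorems.BECCutLineWeakDisorderWitnessTransferVanishNeZero
import Summits.AtomisticToContinuum.BoseEinsteinCondensation.Theorems.BECCutLineWeakDisorderWitnessTransferVanishEqZero
import HarnessLib

/-!
# Route BECCutLineWeakDisorder — crux `WitnessTransfer`: line `Sketch` (final composition)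

Crux item stmt-AtomisticToContinuum-14978,
`Summit.AtomisticToContinuum.BoseEinsteinCondensation.Theses.BECCutLineWeakDisorder.WitnessTransfer`
`= (TwoReplicaTransienceBound → LandscapeBound)`.

All first-generation stubs of the line are theorems of the tree — (B) `stub_heig`
(`…WitnessTransferHeig`), (C) `stub_envelope` (`…Envelope`), (E1a) `stub_formBound` (`…FormBound`),
(E1b) `stub_trialState` (`…TrialState`), (F) `stub_ratio_mollify` (`…RatioMollify`), (G)
`stub_landscape_of_parts` (`…Glue`) — except (E2) `stub_vanish` for a GENERAL admissible `v`
(landed sub-cases: hard spheres `…VanishHardSphere`, strongly repulsive hard sets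
`…VanishStrongRepulsion`, empty hard set `…NoHardSet`; landed reduction to POINTWISE vanishing at
hard-set configurations `stub_vanish_of_pointwise`, `…VanishOfPointwise`).

(E2) in general is proved from seven second-generation stubs, all theorems of the tree, by a
LOCAL-TIME-FREE route: the pair
action `∫₀ᵀ v(|xᵢ − xⱼ + √2 (b(ωᵢ) − b(ωⱼ))_s|) ds` is a.s. infinite from a hard relative position
`y = xᵢ − xⱼ ∈ hardVec v`. Two engines: for `y ≠ 0`, conditioning on the transverse part of the
pair Brownian motion ((S1) independence) reduces to a one-dimensional second-moment /
Paley–Zygmund occupation estimate ((S2)), uniform in small `T`; for `y = 0`, a three-dimensional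
second-moment estimate ((S8)) with the Newtonian potential of a radial charge maximal at the
centre ((S7)). Blumenthal's zero-one law on the `3N` coordinates ((S4)) upgrades the uniform
positive probability to one ((S6), (S9)); `stub_vanish` follows through `stub_vanish_of_pointwise`,
and `WitnessTransfer_of` composes the crux.
-/

noncomputable section

open MeasureTheory ProbabilityTheory Filter Set Metric
open scoped ENNReal NNReal Topology

namespace Summit.AtomisticToContinuum.BoseEinsteinCondensation.Theorems.CutLineWitness

open Literature.MathematicalPhysics.QuantumManyBody.BoseGas
open Literature.Probability.Process

/-! ### Composition: (E2) in general -/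

/-- One pair term is below the interaction: `v(|Yᵢ − Yⱼ|) ≤ ∑_{a<b} v(|Y_a − Y_b|)` (`i ≠ j`).
[folklore] -/
theorem le_interaction_of_ne {N : ℕ} (v : ℝ → ℝ≥0∞) (Y : Config N) {i j : Fin N} (hij : i ≠ j) :
    v (dist (Y i) (Y j)) ≤ interaction v Y := by
  classical
  unfold interaction
  rcases lt_or_gt_of_ne hij with h | h
  · calc v (dist (Y i) (Y j))
        ≤ ∑ b ∈ Finset.univ.filter (fun b => i < b), v (dist (Y i) (Y b)) :=
          Finset.single_le_sum (f := fun b => v (dist (Y i) (Y b))) (fun _ _ => zero_le)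
            (Finset.mem_filter.2 ⟨Finset.mem_univ _, h⟩)
      _ ≤ ∑ a, ∑ b ∈ Finset.univ.filter (fun b => a < b), v (dist (Y a) (Y b)) :=
          Finset.single_le_sum (f := fun a => ∑ b ∈ Finset.univ.filter (fun b => a < b),
            v (dist (Y a) (Y b))) (fun _ _ => zero_le) (Finset.mem_univ i)
  · rw [dist_comm]
    calc v (dist (Y j) (Y i))
        ≤ ∑ b ∈ Finset.univ.filter (fun b => j < b), v (dist (Y j) (Y b)) :=
          Finset.single_le_sum (f := fun b => v (dist (Y j) (Y b))) (fun _ _ => zero_le)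
            (Finset.mem_filter.2 ⟨Finset.mem_univ _, h⟩)
      _ ≤ ∑ a, ∑ b ∈ Finset.univ.filter (fun b => a < b), v (dist (Y a) (Y b)) :=
          Finset.single_le_sum (f := fun a => ∑ b ∈ Finset.univ.filter (fun b => a < b),
            v (dist (Y a) (Y b))) (fun _ _ => zero_le) (Finset.mem_univ j)

/-- The pair action dominates from below the full action: if the pair term integrates to `⊤`,
so does `pathAction`. [folklore] -/
theorem pathAction_eq_top_of_pair {N : ℕ} (v : ℝ → ℝ≥0∞) (T : ℝ) (X : Config N)
    (ω : PathSpace N) {i j : Fin N} (hij : i ≠ j)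
    (h : ∫⁻ s in Set.Ioc 0 T,
      v (dist (worldLine X ω s.toNNReal i) (worldLine X ω s.toNNReal j)) = ⊤) :
    pathAction v T X ω = ⊤ := by
  unfold pathAction
  exact eq_top_iff.2 (h ▸ lintegral_mono fun s => le_interaction_of_ne v _ hij)

/-- If the action is a.s. infinite, the partition function vanishes: `(e^{-TH}1)(X) = 0`.
[folklore] -/
theorem fkSemigroup_one_eq_zero_of_ae {N : ℕ} (v : ℝ → ℝ≥0∞) (L T : ℝ) (X : Config N)
    (h : ∀ᵐ ω ∂wienerPaths N, pathAction v T X ω = ⊤) :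
    fkSemigroup v L T (fun _ => (1 : ℝ≥0∞)) X = 0 := by
  have h0 : wienerPaths N {ω | pathAction v T X ω ≠ ⊤} = 0 := by
    rw [measure_eq_zero_iff_ae_notMem]
    filter_upwards [h] with ω hω
    simpa using hω
  refine le_antisymm ((fkSemigroup_one_le_measure v L T X
    (E := {ω | pathAction v T X ω ≠ ⊤}) fun ω hω => ?_).trans h0.le) bot_le
  simp only [mem_setOf_eq, not_not] at hω
  unfold fkWeight
  by_cases hs : ω ∈ survives L T X
  · rw [indicator_of_mem hs, hω]
    simp [expNeg]
  · rw [indicator_of_notMem hs]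

/-- **(E2) `e^{-TH}1 → 0` uniformly near the hard-set configurations (general `v`).** For an admissible `v`, `T > 0`, `η > 0` there is `κ > 0` with
`(e^{-TH_N}1)(X) ≤ η` whenever some `xᵢ − xⱼ` (`i ≠ j`) is within `κ` of `hardVec v`:
the pointwise vanishing at hard-set configurations ((S6), (S9)) fed into
`stub_vanish_of_pointwise`. [folklore] -/
theorem stub_vanish {N : ℕ} {v : ℝ → ℝ≥0∞} (hv : IsRepulsiveFiniteRange v) (L : ℝ) {T : ℝ}
    (hT : 0 < T) {η : ℝ} (hη : 0 < η) :
    ∃ κ : ℝ, 0 < κ ∧ ∀ X : Config N,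
      (∃ i j : Fin N, i ≠ j ∧ ∃ z ∈ hardVec v, dist (X i - X j) z < κ) →
        fkSemigroup v L T (fun _ => (1 : ℝ≥0∞)) X ≤ ENNReal.ofReal η := by
  refine stub_vanish_of_pointwise hv.1 L hT (fun X ⟨i, j, hij, hz⟩ => ?_) hη
  refine fkSemigroup_one_eq_zero_of_ae v L T X ?_
  by_cases hy : X i - X j = 0
  · have h0 : (0 : Space) ∈ hardVec v := hy ▸ hz
    filter_upwards [stub_pairAction_ae_top_of_eq_zero hv.1 hij h0 (sub_eq_zero.1 hy) hT]
      with ω hω using pathAction_eq_top_of_pair v T X ω hij hω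
  · filter_upwards [stub_pairAction_ae_top_of_ne_zero hv.1 hij hz hy hT]
      with ω hω using pathAction_eq_top_of_pair v T X ω hij hω

end Summit.AtomisticToContinuum.BoseEinsteinCondensation.Theorems.CutLineWitness

/-! ### The composition -/

namespace Summit.AtomisticToContinuum.BoseEinsteinCondensation.Theorems

open Literature.MathematicalPhysics.QuantumManyBody.BoseGas CutLineWitness

/-- **The crux from the stubs**: (B), (C), (E1a), (E1b), (F), (E2) (now from (S1)–(S9)) and the glue (G) give
`WitnessTransfer = (TwoReplicaTransienceBound → LandscapeBound)`. [folklore] -/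
theorem WitnessTransfer_of :
    Summit.AtomisticToContinuum.BoseEinsteinCondensation.Theses.BECCutLineWeakDisorder.WitnessTransfer := by
  intro hTR v hv
  exact stub_landscape_of_parts (fun hv L _ hT h0 _ ht => stub_heig hv L hT h0 ht)
    (fun hv _ hL hN hE => stub_envelope hv hL hN hE)
    (fun hv _ hL _ hΨm _ hM hnn h0 hnorm _ heig => stub_formBound hv hL hΨm hM hnn h0 hnorm heig)
    (fun hv _ hL _ hfm _ hM hnn hsymm hpos _ hSm hSbox _ hr₀ hmargin hSV _ hK hev _ hε =>
      stub_trialState hv hL hfm hM hnn hsymm hpos hSm hSbox hr₀ hmargin hSV hK hev hε)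
    (fun hfm _ hM hnn _ hr₀ h0 _ hε => stub_ratio_mollify hfm hM hnn hr₀ h0 hε)
    (fun hv L _ hT _ hη => stub_vanish hv L hT hη)
    v hv (hTR v hv)

end Summit.AtomisticToContinuum.BoseEinsteinCondensation.Theorems

end
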